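import Summits.KontsevichZagierPeriods.KontsevichZagierPeriods.Theorems.RootDecompRelativeModAbsoluteRegFoldingDegOneP02

/-!
# `RegFoldingDegOne` (route `RootDecompRelativeModAbsolute`, support item stmt-KontsevichZagierPeriods-30571) — PROVED · part 3/14

Cell `decomp-kz`, lens 3 (decomp-kz-lens-3 g9): `regFoldingDegOne_holds :
Theses.RootDecompRelativeModAbsolute.RegFoldingDegOne` BY NAME (in part 14/14) — every Kontsevich–Zagier
integral representation on `ℝ²` whose integrand is a quotient `p/q` of `ℚ`-polynomials with `deg_t q ≤ 1`,
`q ≠ 0` on the domain, is equivalent in `KZ.relations` to `[g] + Σᵢ [Uᵢ]`, the `Uᵢ` honest 2-cells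
`[g.domain × (0,1), hᵢ(x) θ^{Mᵢ}/(1 + θ^{eᵢ} κᵢ(x))]` (unfolded REGULARISED log/arctan monomials), with the
fibre integrals matching a.e.  Architecture: §1–§2 regularised terms `RTerm`, `RegFolding d`; §7 a.e.-congruence;
§8 gluing (`FoldsTo`); §9 one-band toolkit; §P analytic core (kernel independence); §10 cylinders; §11 affine band
chart; §13 `RegFolding 1` from a CAD band cover a.e. + vanishing on unbounded bands; last part: the edge to the born
item text and `regFoldingDegOne_holds`.

Source: `HOME/decomp-kz-lens-3/g9/landing/RootDecompRelativeModAbsoluteRegFoldingDegOne.lean` sha256 60038aa44a5f6303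
(4275 l; critic decomp-kz-crit-1 g2 CLEARED/kernel-confirmed 2026-08-30T09:41:19Z, std axioms), split mechanically
into 14 modules ≤ 400 lines by the landing seat decomp-kz-census-1 g7 (contexts re-opened per part; generic docstrings
added where the source had none; parts 1–13 do not import the route file).  No `sorry`; standard axioms.
References: [cite: KontsevichZagier2001, §1.2]; Basu–Pollack–Roy 2006 Def. 5.1 / Cor. 5.7; Bochnak–Coste–Roy 1998 §2.9.
-/

noncomputable section

open Set MeasureTheory Filter Topology
open scoped BigOperators
open Literature.NumberTheory.Transcendental Literature.ModelTheory.ExponentialFields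

namespace Summit.KontsevichZagierPeriods.RootDecompRelativeModAbsolute.Rung30571

namespace RegularisedLogLayer

namespace RTerm

variable {b : ℕ}

section GlueLemmas

variable (T₁ T₂ : RTerm b)

/-- The zero-extended function of the glued term is the sum of the two zero-extended functions. -/
theorem indicator_integrand_glue (x : Fin b → ℝ) :
    (glue T₁ T₂).domain.indicator (glue T₁ T₂).integrand x =
      T₁.domain.indicator T₁.integrand x + T₂.domain.indicator T₂.integrand x := by
  have hsum : (∑ i, (glue T₁ T₂).h i x * ell ((glue T₁ T₂).M i) ((glue T₁ T₂).e i)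
        ((glue T₁ T₂).κ i x)) =
      T₁.domain.indicator (fun x => ∑ i, T₁.h i x * ell (T₁.M i) (T₁.e i) (T₁.κ i x)) x +
        T₂.domain.indicator (fun x => ∑ j, T₂.h j x * ell (T₂.M j) (T₂.e j) (T₂.κ j x)) x := by
    show (∑ i : Fin (T₁.k + T₂.k), (glue T₁ T₂).h i x * ell ((glue T₁ T₂).M i) ((glue T₁ T₂).e i)
        ((glue T₁ T₂).κ i x)) = _
    rw [Fin.sum_univ_add]
    congr 1
    · rw [Finset.sum_congr rfl fun i _ => congrFun (glue_base_left T₁ T₂ i) x]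
      by_cases h1 : x ∈ T₁.domain
      · simp only [indicator_of_mem h1]
      · simp only [indicator_of_notMem h1, Finset.sum_const_zero]
    · rw [Finset.sum_congr rfl fun j _ => congrFun (glue_base_right T₁ T₂ j) x]
      by_cases h2 : x ∈ T₂.domain
      · simp only [indicator_of_mem h2]
      · simp only [indicator_of_notMem h2, Finset.sum_const_zero]
  by_cases hx : x ∈ T₁.domain ∪ T₂.domain
  · rw [indicator_of_mem (show x ∈ (glue T₁ T₂).domain from hx), integrand, hsum, glue_h₀,
      Pi.add_apply]
    have e1 : T₁.domain.indicator T₁.integrand x = T₁.domain.indicator T₁.h₀ x +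
        T₁.domain.indicator (fun x => ∑ i, T₁.h i x * ell (T₁.M i) (T₁.e i) (T₁.κ i x)) x := by
      by_cases h1 : x ∈ T₁.domain
      · simp only [indicator_of_mem h1, integrand]
      · simp only [indicator_of_notMem h1, add_zero]
    have e2 : T₂.domain.indicator T₂.integrand x = T₂.domain.indicator T₂.h₀ x +
        T₂.domain.indicator (fun x => ∑ j, T₂.h j x * ell (T₂.M j) (T₂.e j) (T₂.κ j x)) x := by
      by_cases h2 : x ∈ T₂.domain
      · simp only [indicator_of_mem h2, integrand]
      · simp only [indicator_of_notMem h2, add_zero]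
    rw [e1, e2]; ring
  · rw [indicator_of_notMem (show x ∉ (glue T₁ T₂).domain from hx)]
    rw [mem_union, not_or] at hx
    rw [indicator_of_notMem hx.1, indicator_of_notMem hx.2, add_zero]

end GlueLemmas

/-- **The glued term of two admissible terms is admissible.** -/
theorem Admissible.glue {T₁ T₂ : RTerm b} (hT₁ : T₁.Admissible) (hT₂ : T₂.Admissible) :
    (T₁.glue T₂).Admissible := by
  have hσ₁ := hT₁.isSemialgebraic_domain
  have hσ₂ := hT₂.isSemialgebraic_domain
  have hσ : IsSemialgebraic ℚ (T₁.domain ∪ T₂.domain) := hσ₁.union hσ₂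
  have hm₁ : MeasurableSet T₁.domain := hσ₁.measurableSet_holds
  have hm₂ : MeasurableSet T₂.domain := hσ₂.measurableSet_holds
  have hcm₁ : MeasurableSet (cyl T₁.domain) := (isSemialgebraic_cyl hσ₁).measurableSet_holds
  have hcm₂ : MeasurableSet (cyl T₂.domain) := (isSemialgebraic_cyl hσ₂).measurableSet_holds
  have hcm : MeasurableSet (cyl (T₁.domain ∪ T₂.domain)) := (isSemialgebraic_cyl hσ).measurableSet_holds
  refine
    { isSemialgebraic_domain := hσ
      isSemialgebraicFunOn_h₀ := ?_
      integrableOn_h₀ := ?_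
      isSemialgebraicFunOn_h := ?_
      isSemialgebraicFunOn_κ := ?_
      e_mem := ?_
      neg_one_lt_κ := ?_
      isSemialgebraicFunOn_monomial := ?_
      integrableOn_monomial := ?_
      integrableOn_monomial_base := ?_ }
  · exact IsSemialgebraicFunOn.add_holds
      (isSemialgebraicFunOn_indicator hσ₁ hσ hT₁.isSemialgebraicFunOn_h₀)
      (isSemialgebraicFunOn_indicator hσ₂ hσ hT₂.isSemialgebraicFunOn_h₀)
  · exact (((integrable_indicator_iff hm₁).2 hT₁.integrableOn_h₀).add
      ((integrable_indicator_iff hm₂).2 hT₂.integrableOn_h₀)).integrableOn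
  · intro i
    refine Fin.addCases (fun i => ?_) (fun j => ?_) i
    · rw [glue_h_left]; exact isSemialgebraicFunOn_indicator hσ₁ hσ (hT₁.isSemialgebraicFunOn_h i)
    · rw [glue_h_right]; exact isSemialgebraicFunOn_indicator hσ₂ hσ (hT₂.isSemialgebraicFunOn_h j)
  · intro i
    refine Fin.addCases (fun i => ?_) (fun j => ?_) i
    · rw [glue_κ_left]; exact isSemialgebraicFunOn_indicator hσ₁ hσ (hT₁.isSemialgebraicFunOn_κ i)
    · rw [glue_κ_right]; exact isSemialgebraicFunOn_indicator hσ₂ hσ (hT₂.isSemialgebraicFunOn_κ j)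
  · intro i
    refine Fin.addCases (fun i => ?_) (fun j => ?_) i
    · rw [glue_e_left]; exact hT₁.e_mem i
    · rw [glue_e_right]; exact hT₂.e_mem j
  · intro i
    refine Fin.addCases (fun i x _ => ?_) (fun j x _ => ?_) i
    · rw [glue_κ_left]
      by_cases hx : x ∈ T₁.domain
      · rw [indicator_of_mem hx]; exact hT₁.neg_one_lt_κ i x hx
      · rw [indicator_of_notMem hx]; norm_num
    · rw [glue_κ_right]
      by_cases hx : x ∈ T₂.domain
      · rw [indicator_of_mem hx]; exact hT₂.neg_one_lt_κ j x hx
      · rw [indicator_of_notMem hx]; norm_num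
  · intro i
    refine Fin.addCases (fun i => ?_) (fun j => ?_) i
    · exact (isSemialgebraicFunOn_indicator (isSemialgebraic_cyl hσ₁) (isSemialgebraic_cyl hσ)
        (hT₁.isSemialgebraicFunOn_monomial i)).congr (eqOn_glue_monomialFun_left T₁ T₂ i)
    · exact (isSemialgebraicFunOn_indicator (isSemialgebraic_cyl hσ₂) (isSemialgebraic_cyl hσ)
        (hT₂.isSemialgebraicFunOn_monomial j)).congr (eqOn_glue_monomialFun_right T₁ T₂ j)
  · intro i
    refine Fin.addCases (fun i => ?_) (fun j => ?_) i
    · exact (((integrable_indicator_iff hcm₁).2 (hT₁.integrableOn_monomial i)).integrableOn).congr_fun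
        (eqOn_glue_monomialFun_left T₁ T₂ i) hcm
    · exact (((integrable_indicator_iff hcm₂).2 (hT₂.integrableOn_monomial j)).integrableOn).congr_fun
        (eqOn_glue_monomialFun_right T₁ T₂ j) hcm
  · intro i
    refine Fin.addCases (fun i => ?_) (fun j => ?_) i
    · rw [glue_base_left]
      exact ((integrable_indicator_iff hm₁).2 (hT₁.integrableOn_monomial_base i)).integrableOn
    · rw [glue_base_right]
      exact ((integrable_indicator_iff hm₂).2 (hT₂.integrableOn_monomial_base j)).integrableOn

/-- The zero-extended base `[σ₁ ∪ σ₂, 1_{σ₁} h₀¹]` as a representation (auxiliary). -/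
def extendRep (T₁ : RTerm b) (hT₁ : T₁.Admissible) {S : Set (Fin b → ℝ)} (hS : IsSemialgebraic ℚ S) :
    KZ.IntegralRep b :=
  ⟨S, T₁.domain.indicator T₁.h₀, hS,
    isSemialgebraicFunOn_indicator hT₁.isSemialgebraic_domain hS hT₁.isSemialgebraicFunOn_h₀,
    ((integrable_indicator_iff hT₁.isSemialgebraic_domain.measurableSet_holds).2
      hT₁.integrableOn_h₀).integrableOn⟩

/-- `extendRep_sub_baseRep_mem`: auxiliary theorem of the `RegFoldingDegOne` (stmt-30571) development — see the module docstring; statement and proof verbatim from the lens-3 g9 landing file. -/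
theorem extendRep_sub_baseRep_mem (T₁ : RTerm b) (hT₁ : T₁.Admissible) {S : Set (Fin b → ℝ)}
    (hS : IsSemialgebraic ℚ S) (hsub : T₁.domain ⊆ S) :
    KZ.of (extendRep T₁ hT₁ hS) - KZ.of (baseRep T₁ hT₁) ∈ KZ.relations := by
  refine AECongr.of_sub_of_mem_relations_of_indicator_ae _ _ (Eventually.of_forall fun x => ?_)
  show S.indicator (T₁.domain.indicator T₁.h₀) x = T₁.domain.indicator T₁.h₀ x
  rw [Set.indicator_indicator, inter_eq_right.2 hsub]

/-- **Unfolding the glued term = the sum of the unfoldings, modulo `KZ.relations`.** -/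
theorem unfold_glue_sub_mem (T₁ T₂ : RTerm b) (hT₁ : T₁.Admissible) (hT₂ : T₂.Admissible) :
    unfold (T₁.glue T₂) (hT₁.glue hT₂) - unfold T₁ hT₁ - unfold T₂ hT₂ ∈ KZ.relations := by
  have hσ : IsSemialgebraic ℚ (T₁.domain ∪ T₂.domain) :=
    hT₁.isSemialgebraic_domain.union hT₂.isSemialgebraic_domain
  set G := T₁.glue T₂ with hG
  set hG' := hT₁.glue hT₂
  set r₁' := extendRep T₁ hT₁ hσ
  set r₂' := extendRep T₂ hT₂ hσ
  -- base: integrand additivity, then shrink each zero-extended base back to its own domain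
  have hbase : KZ.of (baseRep G hG') - KZ.of r₁' - KZ.of r₂' ∈ KZ.relations :=
    KZ.integrandAddRel_subset_relations ⟨b, baseRep G hG', r₁', r₂', rfl, rfl, fun x _ => rfl, rfl⟩
  have h₁ := extendRep_sub_baseRep_mem T₁ hT₁ hσ subset_union_left
  have h₂ := extendRep_sub_baseRep_mem T₂ hT₂ hσ subset_union_right
  -- monomials: a.e. (indeed everywhere) congruence of the zero-extended integrands
  have hmono₁ : ∀ i : Fin T₁.k, KZ.of (monomialRep G hG' (Fin.castAdd T₂.k i)) -
      KZ.of (monomialRep T₁ hT₁ i) ∈ KZ.relations := fun i => by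
    refine AECongr.of_sub_of_mem_relations_of_indicator_ae _ _ (Eventually.of_forall fun z => ?_)
    show (cyl (T₁.domain ∪ T₂.domain)).indicator (G.monomialFun (Fin.castAdd T₂.k i)) z =
      (cyl T₁.domain).indicator (T₁.monomialFun i) z
    rw [glue_monomialFun_left, Set.indicator_indicator, cyl_inter_slab_left]
  have hmono₂ : ∀ j : Fin T₂.k, KZ.of (monomialRep G hG' (Fin.natAdd T₁.k j)) -
      KZ.of (monomialRep T₂ hT₂ j) ∈ KZ.relations := fun j => by
    refine AECongr.of_sub_of_mem_relations_of_indicator_ae _ _ (Eventually.of_forall fun z => ?_)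
    show (cyl (T₁.domain ∪ T₂.domain)).indicator (G.monomialFun (Fin.natAdd T₁.k j)) z =
      (cyl T₂.domain).indicator (T₂.monomialFun j) z
    rw [glue_monomialFun_right, Set.indicator_indicator, cyl_inter_slab_right]
  have key : unfold G hG' - unfold T₁ hT₁ - unfold T₂ hT₂ =
      (KZ.of (baseRep G hG') - KZ.of r₁' - KZ.of r₂') + (KZ.of r₁' - KZ.of (baseRep T₁ hT₁)) +
        (KZ.of r₂' - KZ.of (baseRep T₂ hT₂)) +
        ∑ i : Fin T₁.k, (KZ.of (monomialRep G hG' (Fin.castAdd T₂.k i)) - KZ.of (monomialRep T₁ hT₁ i)) +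
        ∑ j : Fin T₂.k, (KZ.of (monomialRep G hG' (Fin.natAdd T₁.k j)) - KZ.of (monomialRep T₂ hT₂ j)) := by
    simp only [unfold, Finset.sum_sub_distrib]
    rw [show (∑ i : Fin G.k, KZ.of (monomialRep G hG' i)) =
        ∑ i : Fin (T₁.k + T₂.k), KZ.of (monomialRep G hG' i) from rfl, Fin.sum_univ_add]
    abel
  rw [key]
  exact add_mem (add_mem (add_mem (add_mem hbase h₁) h₂) (sum_mem fun i _ => hmono₁ i))
    (sum_mem fun j _ => hmono₂ j)

/-- The empty term (no base, no monomials). -/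
def empty (b : ℕ) : RTerm b := ⟨∅, 0, 0, Fin.elim0, Fin.elim0, Fin.elim0, Fin.elim0⟩

/-- `empty_admissible`: auxiliary theorem of the `RegFoldingDegOne` (stmt-30571) development — see the module docstring; statement and proof verbatim from the lens-3 g9 landing file. -/
theorem empty_admissible (b : ℕ) : (empty b).Admissible where
  isSemialgebraic_domain := isSemialgebraic_empty
  isSemialgebraicFunOn_h₀ := by
    rw [isSemialgebraicFunOn_iff]
    convert (isSemialgebraic_empty : IsSemialgebraic ℚ (∅ : Set (Fin (b + 1) → ℝ))) using 1
    ext z; simp [empty]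
  integrableOn_h₀ := by simp [empty]
  isSemialgebraicFunOn_h := fun i => i.elim0
  isSemialgebraicFunOn_κ := fun i => i.elim0
  e_mem := fun i => i.elim0
  neg_one_lt_κ := fun i => i.elim0
  isSemialgebraicFunOn_monomial := fun i => i.elim0
  integrableOn_monomial := fun i => i.elim0
  integrableOn_monomial_base := fun i => i.elim0

end RTerm

section Folds

variable {b : ℕ}

/-- **`FoldsTo r T hT`**: `[r] ≡ unfold T` in `KZ.relations` and the fibre integrals of `r` are the
zero-extended function of `T` a.e. (the conclusion of `RegFolding` for one `r`). -/
def FoldsTo (r : KZ.IntegralRep (b + 1)) (T : RTerm b) (hT : T.Admissible) : Prop :=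
  KZ.of r - RTerm.unfold T hT ∈ KZ.relations ∧
    ∀ᵐ x : (Fin b → ℝ), (∫ t in {t : ℝ | (Fin.snoc x t : Fin (b + 1) → ℝ) ∈ r.domain},
      r.integrand (Fin.snoc x t)) = T.domain.indicator T.integrand x

/-- `RegFolding d` is literally its `FoldsTo` form. -/
theorem regFolding_iff_foldsTo (d : ℕ) :
    RegFolding d ↔ ∀ r : KZ.IntegralRep (1 + 1), IsRationalDegLE d r →
      ∃ (T : RTerm 1) (hT : T.Admissible), FoldsTo r T hT :=
  Iff.rfl

/-- Fibre integrals are additive over a null-overlap domain split with the same integrand, a.e. -/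
theorem fibre_add_ae {r r₁ r₂ : KZ.IntegralRep (b + 1)} (hdom : r.domain = r₁.domain ∪ r₂.domain)
    (hnull : volume (r₁.domain ∩ r₂.domain) = 0) (he₁ : EqOn r.integrand r₁.integrand r₁.domain)
    (he₂ : EqOn r.integrand r₂.integrand r₂.domain) :
    ∀ᵐ x : (Fin b → ℝ), (∫ t in {t : ℝ | (Fin.snoc x t : Fin (b + 1) → ℝ) ∈ r.domain},
        r.integrand (Fin.snoc x t)) =
      (∫ t in {t : ℝ | (Fin.snoc x t : Fin (b + 1) → ℝ) ∈ r₁.domain}, r₁.integrand (Fin.snoc x t)) +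
        ∫ t in {t : ℝ | (Fin.snoc x t : Fin (b + 1) → ℝ) ∈ r₂.domain}, r₂.integrand (Fin.snoc x t) := by
  have hae : ∀ᵐ z : (Fin (b + 1) → ℝ), r.domain.indicator r.integrand z =
      r₁.domain.indicator r₁.integrand z + r₂.domain.indicator r₂.integrand z := by
    filter_upwards [measure_eq_zero_iff_ae_notMem.1 hnull] with z hz
    by_cases h1 : z ∈ r₁.domain
    · by_cases h2 : z ∈ r₂.domain
      · exact absurd ⟨h1, h2⟩ hz
      · rw [indicator_of_mem (hdom ▸ Or.inl h1 : z ∈ r.domain), indicator_of_mem h1,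
          indicator_of_notMem h2, add_zero, he₁ h1]
    · by_cases h2 : z ∈ r₂.domain
      · rw [indicator_of_mem (hdom ▸ Or.inr h2 : z ∈ r.domain), indicator_of_notMem h1,
          indicator_of_mem h2, zero_add, he₂ h2]
      · have hz' : z ∉ r.domain := by rw [hdom]; rintro (h | h) <;> contradiction
        rw [indicator_of_notMem hz', indicator_of_notMem h1, indicator_of_notMem h2, add_zero]
  have hi₁ := ae_integrable_snoc ((integrable_indicator_iff
    (KZ.IntegralRep.measurableSet_domain_holds r₁)).2 r₁.integrableOn)
  have hi₂ := ae_integrable_snoc ((integrable_indicator_iff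
    (KZ.IntegralRep.measurableSet_domain_holds r₂)).2 r₂.integrableOn)
  filter_upwards [ae_ae_snoc hae, hi₁, hi₂] with x hx i1 i2
  rw [← integral_indicator_snoc r, ← integral_indicator_snoc r₁, ← integral_indicator_snoc r₂,
    integral_congr_ae hx, integral_add i1 i2]

/-- **Gluing along a domain split.** -/
theorem FoldsTo.glue {r r₁ r₂ : KZ.IntegralRep (b + 1)} {T₁ T₂ : RTerm b} {hT₁ : T₁.Admissible}
    {hT₂ : T₂.Admissible} (hdom : r.domain = r₁.domain ∪ r₂.domain)
    (hnull : volume (r₁.domain ∩ r₂.domain) = 0) (he₁ : EqOn r.integrand r₁.integrand r₁.domain)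
    (he₂ : EqOn r.integrand r₂.integrand r₂.domain) (h₁ : FoldsTo r₁ T₁ hT₁) (h₂ : FoldsTo r₂ T₂ hT₂) :
    FoldsTo r (T₁.glue T₂) (hT₁.glue hT₂) := by
  refine ⟨?_, ?_⟩
  · have hadd : KZ.of r - KZ.of r₁ - KZ.of r₂ ∈ KZ.domainAddRel :=
      ⟨_, r, r₁, r₂, hdom, hnull, he₁, he₂, rfl⟩
    have hu := RTerm.unfold_glue_sub_mem T₁ T₂ hT₁ hT₂
    have e : KZ.of r - RTerm.unfold (T₁.glue T₂) (hT₁.glue hT₂) =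
        (KZ.of r - KZ.of r₁ - KZ.of r₂) + (KZ.of r₁ - RTerm.unfold T₁ hT₁) +
          (KZ.of r₂ - RTerm.unfold T₂ hT₂) -
          (RTerm.unfold (T₁.glue T₂) (hT₁.glue hT₂) - RTerm.unfold T₁ hT₁ - RTerm.unfold T₂ hT₂) := by
      abel
    rw [e]
    exact sub_mem (add_mem (add_mem (KZ.domainAddRel_subset_relations hadd) h₁.1) h₂.1) hu
  · filter_upwards [fibre_add_ae hdom hnull he₁ he₂, h₁.2, h₂.2] with x hx hx₁ hx₂
    rw [hx, hx₁, hx₂, RTerm.indicator_integrand_glue]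

/-- **Null-set removal.** -/
theorem FoldsTo.of_restrict {r : KZ.IntegralRep (b + 1)} {E : Set (Fin (b + 1) → ℝ)}
    (hE : IsSemialgebraic ℚ E) (hEr : E ⊆ r.domain) (hvol : volume (r.domain \ E) = 0)
    {T : RTerm b} {hT : T.Admissible} (h : FoldsTo (r.restrict E hE hEr) T hT) : FoldsTo r T hT := by
  refine ⟨?_, ?_⟩
  · have h1 := KZ.IntegralRep.of_sub_of_restrict_mem_relations r hE hEr hvol
    have e : KZ.of r - RTerm.unfold T hT = (KZ.of r - KZ.of (r.restrict E hE hEr)) +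
        (KZ.of (r.restrict E hE hEr) - RTerm.unfold T hT) := by abel
    rw [e]
    exact add_mem h1 h.1
  · have hae : ∀ᵐ z : (Fin (b + 1) → ℝ), r.domain.indicator r.integrand z =
        E.indicator r.integrand z := by
      filter_upwards [measure_eq_zero_iff_ae_notMem.1 hvol] with z hz
      by_cases hzE : z ∈ E
      · rw [indicator_of_mem (hEr hzE), indicator_of_mem hzE]
      · have hzD : z ∉ r.domain := fun hzD => hz ⟨hzD, hzE⟩
        rw [indicator_of_notMem hzD, indicator_of_notMem hzE]
    filter_upwards [ae_ae_snoc hae, h.2] with x hx hxT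
    rw [← hxT, ← integral_indicator_snoc r, integral_congr_ae hx]
    exact integral_indicator_snoc (r.restrict E hE hEr) x

/-- A representation with null domain folds to the empty term. -/
theorem foldsTo_empty_of_null {r : KZ.IntegralRep (b + 1)} (hr : volume r.domain = 0) :
    FoldsTo r (RTerm.empty b) (RTerm.empty_admissible b) := by
  refine ⟨?_, ?_⟩
  · have h1 : KZ.of r ∈ KZ.relations := KZ.of_mem_relations_of_volume_eq_zero r hr
    have h2 : KZ.of (RTerm.baseRep (RTerm.empty b) (RTerm.empty_admissible b)) ∈ KZ.relations :=
      KZ.of_mem_relations_of_volume_eq_zero _ (by simp [RTerm.empty])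
    have e : RTerm.unfold (RTerm.empty b) (RTerm.empty_admissible b) =
        KZ.of (RTerm.baseRep (RTerm.empty b) (RTerm.empty_admissible b)) := by
      simp [RTerm.unfold, RTerm.empty]
    rw [e]
    exact sub_mem h1 h2
  · have hae : ∀ᵐ z : (Fin (b + 1) → ℝ), r.domain.indicator r.integrand z = 0 := by
      filter_upwards [measure_eq_zero_iff_ae_notMem.1 hr] with z hz
      rw [indicator_of_notMem hz]
    filter_upwards [ae_ae_snoc hae] with x hx
    rw [← integral_indicator_snoc r, integral_congr_ae hx, integral_zero]
    simp [RTerm.empty]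

/-- `iUnion_fin_succ`: auxiliary theorem of the `RegFoldingDegOne` (stmt-30571) development — see the module docstring; statement and proof verbatim from the lens-3 g9 landing file. -/
theorem iUnion_fin_succ {α : Type*} {N : ℕ} (D : Fin (N + 1) → Set α) :
    (⋃ j, D j) = (⋃ j : Fin N, D (Fin.castSucc j)) ∪ D (Fin.last N) := by
  ext z
  simp only [mem_iUnion, mem_union]
  constructor
  · rintro ⟨j, hj⟩
    induction j using Fin.lastCases with
    | last => exact Or.inr hj
    | cast j => exact Or.inl ⟨j, hj⟩
  · rintro (⟨j, hj⟩ | hj)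
    · exact ⟨_, hj⟩
    · exact ⟨_, hj⟩

/-- `isSemialgebraic_iUnion_fin`: auxiliary theorem of the `RegFoldingDegOne` (stmt-30571) development — see the module docstring; statement and proof verbatim from the lens-3 g9 landing file. -/
theorem isSemialgebraic_iUnion_fin {N : ℕ} {D : Fin N → Set (Fin (b + 1) → ℝ)}
    (hD : ∀ j, IsSemialgebraic ℚ (D j)) : IsSemialgebraic ℚ (⋃ j, D j) := by
  induction N with
  | zero => simp
  | succ N ih =>
    rw [iUnion_fin_succ]
    exact (ih fun j => hD _).union (hD _)

end Folds

end RegularisedLogLayer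

end Summit.KontsevichZagierPeriods.RootDecompRelativeModAbsolute.Rung30571

end
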